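/- Copyright: the b2b-balaban cell (near-miss cell 7), T⁴-continuum fan-out; row NE7b ROUND-2 swarm, seat
t4-ne7b-formalise-leaf-06 (gen 7) (road W-RP, sub-row «W-LAB», file 4: the cube labelling READ BY A TEMPLATE READER —
`lab_meas`∕`loc`∕`equiv` from 4t's cube template theorems BY NAME; INTENT journal l.17482).  Released under the licence
of the surrounding project. -/
import Summits.QuantumFields.BalabanUV.T4Continuum.Support.HistoryChessboardEventsTemplates
import Summits.QuantumFields.BalabanUV.T4Continuum.Support.HistoryChessboardLabels

/-!
# Road W-RP, sub-row «W-LAB», file 4: THE CUBE LABELLING READ BY A TEMPLATE READER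

Summits-side support leaf of the T⁴-continuum cell (rung (B)+1 on a FINITE torus only; NOT infinite volume, NOT the
mass gap, NOT the Clay statement; NOT a proof of the spine estimate NE7b).  Row NE7b, road **W-RP** (R-OWNER-23-2 ∕
R-OWNER-23-8), sub-row «W-LAB», file 4: the junction, BY NAME, of file 1 (`HistoryChessboardLabels`: `LabelSide`,
`equiv_of_preimage`) with leaf-04 g7's «4t» (`HistoryChessboardEventsTemplates`: template events on CUBE cells —
`cubeCorner`, `tEvent_E_meas_cubes`, `tEvent_loc_cubes`, `tEvent_sym_cubes` — over W3o `HistoryRPTowerTemplates`: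
`tEvent`, `towerBox`, `towerRefl`, `towerTranslate`).  [folklore] bookkeeping over TREE theorems; ONE hypothesis SHAPE
`structure CubeReaderSide … : Prop` (consumed only as a binder); no definition of data, no `[cite:]` tag, no
`Prop`-valued FACT minted (c1), no constant (c2∕c6), no exit ∕ socket ∕ `HistoryConstants` file touched (c3); nothing of
4t ∕ W3o ∕ file 1 restated.

WHY.  File 1 reads the cell events off a LABELLING `lab : Ω → BlockIdx d N → Λ` and keeps `lab_meas`∕`loc` as clauses and
(R-sym) as the pointwise equivariance `equiv`; 4t reads cell events off ONE TEMPLATE per pattern carried to every cube by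
the tower translations and makes `E_meas`∕`loc`∕`sym` theorems of two template clauses.  The two meet when the labelling
is READ BY ONE TEMPLATE READER `f : Tower P G K → Λ`: `lab ω c := f (towerTranslate K (cubeCorner h c) ω)` — then the
label event `{ω | lab ω c = l}` IS 4t's template event `tEvent K (f ⁻¹' {l}) (cubeCorner h c)` (definitionally), so
`lab_meas`∕`loc` come from the reader's box measurability and `equiv` from ONE pointwise reader symmetry per axis.

WHAT.  `labelSet_reader` (the definitional identity), `preimage_fibre_eq_of_reader` (pointwise reader symmetry ⇒ 4t's
template symmetry `hR` for every fibre); **`structure CubeReaderSide (h : P.sitesPerDir K = M·N) Pat T A Bad μ Z term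
obs ob f r`** = file 1's `LabelSide` at `θ := cubeRefl h`, `mP := cubePos G h`, `lab := (f ∘ towerTranslate K
(cubeCorner h ·))` with `lab_meas`∕`loc`∕`equiv` REPLACED by `read_meas : ∀ l ∈ Pat, MeasurableSet[towerBox G K M K]
(f ⁻¹' {l})` and `read_sym : ∀ i ω, f (towerRefl i K ω) = f (towerTranslate K (-axisVec P K i M) ω)`;
**`CubeReaderSide.labelSide (hK : K ≤ m + K_P)`** (4t's `tEvent_E_meas_cubes`∕`tEvent_loc_cubes`∕`tEvent_sym_cubes` + file
1's `equiv_of_preimage` BY NAME) and `CubeReaderSide.eventSide` (4a's `EventSide`; 4c's END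
`hybridNE7_of_towerEventSidesCubes_SU` then applies verbatim).

HONEST SCOPE (R-OWNER-23-8 wording for road W-RP).  Displayed for an instantiating seat of a reader-labelled run: the
READER `f` (which field-size functional of the reference cube column is read — that Bałaban's large-field classes ARE
its fibres: (EXT) proper), its two clauses `read_meas`∕`read_sym`, the term label (`range`, `term_meas`), `repr`
(weights = fibre masses), `bad_lab`, `univ_le` ((U1)+(G2)), bookkeeping; + NE7c ∕ NE7 ∕ rates downstream.  Nothing of
H3 ∕ (B) ∕ BetaPertH discharged; 0∕9 unchanged.  NE7b NOT proved; spine 0∕9.  HONEST DEPENDENCY (cell): continuum YM on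
T⁴ ⇐ BetaPertH ∧ nine spine estimates (0/9 proved); BetaPertH ⇐ (D1) ∧ (D4) ∧ CAP+tail; G-an2-4 gates asym, D1 and
NE2/3/4.  This file changes none of it.
-/

open Finset MeasureTheory Literature.Barriers.CriticalPhenomena.NonGibbs Literature.Probability.LatticeModels
open Literature.MathematicalPhysics.QuantumFieldTheory.Balaban1983to89
open T4IndicatorShell T4MatchingAssembly T4MatchingClosure
open Summit.QuantumFields.BalabanUV.T4Continuum HistoryChessboardEventsSplit HistoryChessboardEventsTower
open HistoryChessboardEventsCubes HistoryRPTowerLaw HistoryRPTowerCuts HistoryRPTowerTemplates HistoryRPTowerUniform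
open HistoryChessboardEventsTemplates HistoryChessboardLabels BlockAveraging

namespace Summit.QuantumFields.BalabanUV.T4Continuum.HistoryChessboardLabelsReader

noncomputable section

/-! ## §1 A cube labelling read by a template reader -/

section Reader

variable {P : Params} {G : Type*} [GaugeGroup G] [MeasurableSpace G] {M N K : ℕ} {ι Λ : Type*}

omit [GaugeGroup G] [MeasurableSpace G] in
/-- **THE LABEL EVENTS OF A READER LABELLING ARE 4t's TEMPLATE EVENTS OF THE READER'S FIBRES** (definitional): the label of
the cube `c` is the reader's value on the state carried back by the cube's corner. [folklore] -/
theorem labelSet_reader (h : P.sitesPerDir K = M * N) (f : Tower P G K → Λ) (l : Λ) (c : BlockIdx P.d N) :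
    {ω | f (towerTranslate K (cubeCorner h c) ω) = l} = tEvent K (f ⁻¹' {l}) (cubeCorner h c) := rfl

omit [GaugeGroup G] [MeasurableSpace G] in
/-- a POINTWISE symmetry of the reader gives the template symmetry of every fibre (4t's `hR` shape). [folklore] -/
theorem preimage_fibre_eq_of_reader {f : Tower P G K → Λ} {R S : Tower P G K → Tower P G K}
    (h : ∀ ω, f (R ω) = f (S ω)) (l : Λ) : R ⁻¹' (f ⁻¹' {l}) = S ⁻¹' (f ⁻¹' {l}) :=
  Set.ext fun ω => by simp only [Set.mem_preimage, Set.mem_singleton_iff, h]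

/-- **THE READER LABELLED READING ON THE CUBE TORUS** (HYPOTHESIS SHAPE — NOTHING asserted): file 2's `CubeLabelSide`
for the cube labelling `lab ω c := f (towerTranslate K (cubeCorner h c) ω)` READ BY ONE TEMPLATE READER
`f : Tower P G K → Λ`, with the labelling clauses `col`∕`equiv` REPLACED by two clauses on the reader: `read_meas` (the
reader's bad fibres are events of the reference cube column `towerBox G K M K`) and `read_sym` (pointwise: reading the
reflected state = reading the state carried to the mirror cube). [folklore] -/
structure CubeReaderSide [NeZero N] (h : P.sitesPerDir K = M * N) (Pat : Finset Λ) (T : Finset ι) (A : ℝ → ι → ℝ)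
    (Bad : Finset ι) (μ : Measure (Tower P G K)) (Z : ℝ) (term : Tower P G K → ι) (obs : Tower P G K → ℝ) (ob : ℝ)
    (f : Tower P G K → Λ) (r : ℝ) : Prop where
  /-- the undressed partition function is positive -/
  Z_pos : 0 < Z
  /-- the bad class consists of terms -/
  bad_subset : Bad ⊆ T
  /-- every state belongs to a term of `T` -/
  range : ∀ ω, term ω ∈ T
  /-- term events are measurable -/
  term_meas : ∀ τ ∈ T, MeasurableSet (term ⁻¹' {τ})
  /-- the source observable is measurable … -/
  obs_meas : Measurable obs
  /-- … and bounded by `ob` -/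
  obs_bdd : ∀ ω, |obs ω| ≤ ob
  /-- the bound is nonnegative -/
  ob_nonneg : 0 ≤ ob
  /-- (EXT)+(DRESS): the dressed weight of a term is the source-dressed mass of its fibre -/
  repr : ∀ (t : ℝ), ∀ τ ∈ T, A t τ = Z * ∫ ω in term ⁻¹' {τ}, Real.exp (t * obs ω) ∂μ
  /-- (EXT)∘(LOC), pointwise: a state in a bad term reads a bad label at some cube -/
  bad_lab : ∀ ω, term ω ∈ Bad → ∃ c : BlockIdx P.d N, f (towerTranslate K (cubeCorner h c) ω) ∈ Pat
  /-- (LOC): the reader's bad fibres are events of the reference cube column -/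
  read_meas : ∀ l ∈ Pat, MeasurableSet[towerBox G K M K] (f ⁻¹' {l})
  /-- (R-sym), pointwise: the reader on the reflected state = the reader on the state carried to the mirror cube -/
  read_sym : ∀ (i : Fin P.d) (ω : Tower P G K),
    f (towerRefl i K ω) = f (towerTranslate K (-axisVec P K i M) ω)
  /-- (U1)+(G2), ratio currency: the pattern «every cube reads the bad label `l`» has probability `≤ r^(N^d)` -/
  univ_le : ∀ l ∈ Pat, μ.real {ω | ∀ c : BlockIdx P.d N, f (towerTranslate K (cubeCorner h c) ω) = l} ≤ r ^ (N ^ P.d)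
  /-- the per-cell rate is nonnegative -/
  r_nonneg : 0 ≤ r

variable [NeZero N] {h : P.sitesPerDir K = M * N} {Pat : Finset Λ} {T : Finset ι} {A : ℝ → ι → ℝ} {Bad : Finset ι}
  {μ : Measure (Tower P G K)} {Z : ℝ} {term : Tower P G K → ι} {obs : Tower P G K → ℝ} {ob : ℝ}
  {f : Tower P G K → Λ} {r : ℝ}

/-- **THE READER LABELLED READING IS A LABELLED READING** relative to `cubeRefl h` ∕ `cubePos G h` (`K ≤ m + K_P`):
`lab_meas`∕`loc` by 4t's `tEvent_E_meas_cubes`∕`tEvent_loc_cubes`, `equiv` by 4t's `tEvent_sym_cubes` through file 1's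
`equiv_of_preimage` — all BY NAME. [folklore] -/
theorem CubeReaderSide.labelSide (H : CubeReaderSide h Pat T A Bad μ Z term obs ob f r) (hK : K ≤ P.m + P.K) :
    LabelSide P.d N Pat T A Bad μ Z term obs ob (fun ω c => f (towerTranslate K (cubeCorner h c) ω)) (cubeRefl h)
      (cubePos G h) r where
  Z_pos := H.Z_pos
  bad_subset := H.bad_subset
  range := H.range
  term_meas := H.term_meas
  lab_meas := tEvent_E_meas_cubes h (tmpl := fun l => f ⁻¹' {l}) fun l hl => measurableSet_of_towerBox (H.read_meas l hl)
  obs_meas := H.obs_meas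
  obs_bdd := H.obs_bdd
  ob_nonneg := H.ob_nonneg
  repr := H.repr
  bad_lab := H.bad_lab
  loc := tEvent_loc_cubes hK h (tmpl := fun l => f ⁻¹' {l}) H.read_meas
  equiv := equiv_of_preimage fun l i k c =>
    tEvent_sym_cubes h (Pat := ({l} : Finset Λ)) (tmpl := fun l' => f ⁻¹' {l'})
      (fun l' _ i' => preimage_fibre_eq_of_reader (H.read_sym i') l') l (Finset.mem_singleton_self l) i k c
  univ_le := H.univ_le
  r_nonneg := H.r_nonneg

/-- … hence 4a's event half over the cube torus. [folklore] -/
theorem CubeReaderSide.eventSide (H : CubeReaderSide h Pat T A Bad μ Z term obs ob f r) (hK : K ≤ P.m + P.K) :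
    EventSide P.d N Pat T A Bad μ Z (fun τ => term ⁻¹' {τ}) obs ob
      (fun l c => {ω | f (towerTranslate K (cubeCorner h c) ω) = l}) (cubeRefl h) (cubePos G h) r :=
  (H.labelSide hK).eventSide

/-- the term events are measurable (W-E1's `hmeas` shape). [folklore] -/
theorem CubeReaderSide.ev_meas (H : CubeReaderSide h Pat T A Bad μ Z term obs ob f r) :
    ∀ τ ∈ T, MeasurableSet (term ⁻¹' {τ}) :=
  H.term_meas

/-- the term events cover (W-E1's `hcover` shape). [folklore] -/
theorem CubeReaderSide.ev_cover (H : CubeReaderSide h Pat T A Bad μ Z term obs ob f r) :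
    Set.univ ⊆ ⋃ τ ∈ T, term ⁻¹' {τ} :=
  cover_fibre H.range

/-- all term events are pairwise disjoint (W-E1's `hdisj` shape; Mathlib's `Set.pairwiseDisjoint_fiber`). [folklore] -/
theorem CubeReaderSide.ev_disj (_H : CubeReaderSide h Pat T A Bad μ Z term obs ob f r) :
    (↑T : Set ι).PairwiseDisjoint fun τ => term ⁻¹' {τ} :=
  Set.pairwiseDisjoint_fiber term _

end Reader

end

end Summit.QuantumFields.BalabanUV.T4Continuum.HistoryChessboardLabelsReader
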